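import Mathlib
import Summits.Ventures.DiscreteObjects.Mahler.CensusKernelDeg26Final
import Summits.Ventures.DiscreteObjects.Mahler.SubLehmerDegreeTwentySix
import Summits.Ventures.DiscreteObjects.Mahler.MahlerMeasureCompXPow

/-!
# Lehmer's conjecture for every integer polynomial of degree ≤ 27, in the kernel (venture `DiscreteObjects`, target L)

Cell `pub-namedobj`, seats `pub-namedobj-mahler-g19`/`g20`/`g21`/`g22`, filed by `g26` (text transposed from seat g18's `SubLehmerDegreeTwentySix`; draft of
mahler g19, assembled by mahler g21/g22).  Framing: lottery ticket; floor = certified bounds/negative ranges.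

From `CensusKernelDeg26Final` (degree-26 kernel census at the LEHMER bound `20/17`: EMPTY row, `lehmer_le_of_irreducible_degree_twentysix`,
degrees 26/27) and `SubLehmerDegreeTwentySix` (degrees `≤ 25`, from the degree-24 kernel census at `20/17`):
* `lehmer_le_of_irreducible_of_natDegree_le_twentyseven`, `lehmer_le_of_natDegree_le_twentyseven` — every `P ∈ ℤ[X]` of degree `≤ 27`
  with `M(P) > 1` has `M(P) ≥ M(ℓ)`;
* `twentyeight_le_natDegree_of_subLehmer`, `ne_expand_of_subLehmer_of_natDegree_lt_fiftysix` (a sub-Lehmer `P` of degree `< 56` is primitive),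
  rungs `N ≤ 27` of the cell's sub-Lehmer ladder, cells `d ≤ 27`, `kernelCensus_le_twentyseven`.
CONTROL rows (published complete lists reach degree 44; Lehmer's bound is known in print for every degree ≤ 54, MRW08 Table 1);
kernel theorems with the standard axioms.
-/

namespace Summit.Ventures.DiscreteObjects.Mahler

open Polynomial

open Literature.NumberTheory.MahlerMeasure

/-- **Irreducible polynomials of degree `≤ 27` satisfy Lehmer's bound.** -/
theorem lehmer_le_of_irreducible_of_natDegree_le_twentyseven {P : ℤ[X]} (hirr : Irreducible P)
    (hdeg : P.natDegree ≤ 27) (h1 : 1 < intMahlerMeasure P) :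
    intMahlerMeasure lehmerPoly ≤ intMahlerMeasure P := by
  by_cases h25 : P.natDegree ≤ 25
  · exact lehmer_le_of_irreducible_of_natDegree_le_twentyfive hirr h25 h1
  · exact lehmer_le_of_irreducible_of_natDegree_twentysix_or_twentyseven hirr (by omega) hdeg h1

/-- **Lehmer's conjecture holds for every integer polynomial of degree `≤ 27`:** `M(P) > 1 ⇒ M(P) ≥ M(ℓ)`. -/
theorem lehmer_le_of_natDegree_le_twentyseven {p : ℤ[X]} (hdeg : p.natDegree ≤ 27) (h1 : 1 < intMahlerMeasure p) :
    intMahlerMeasure lehmerPoly ≤ intMahlerMeasure p := by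
  classical
  have hp : p ≠ 0 := by
    intro h
    rw [h] at h1
    unfold intMahlerMeasure at h1
    rw [Polynomial.map_zero, mahlerMeasure_zero] at h1
    linarith
  obtain ⟨u, hu⟩ := UniqueFactorizationMonoid.factors_prod hp
  obtain ⟨c, hc, hcu⟩ := Polynomial.isUnit_iff.mp u.isUnit
  set F := UniqueFactorizationMonoid.factors p with hF
  have hFirr : ∀ f ∈ F, Irreducible f := fun f hf => UniqueFactorizationMonoid.irreducible_of_factor f hf
  have hMu : intMahlerMeasure (↑u : ℤ[X]) = 1 := by
    rw [← hcu, intMahlerMeasure_C]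
    rcases Int.isUnit_iff.mp hc with h | h <;> simp [h]
  have hMp : intMahlerMeasure p = (F.map intMahlerMeasure).prod := by
    rw [← hu, intMahlerMeasure_mul, hMu, mul_one, intMahlerMeasure_multiset_prod]
  have hdvd : ∀ f ∈ F, f ∣ p := fun f hf => (Multiset.dvd_prod hf).trans ⟨↑u, hu.symm⟩
  have hge1 : ∀ x ∈ F.map intMahlerMeasure, 1 ≤ x := by
    intro x hx
    obtain ⟨f, hf, rfl⟩ := Multiset.mem_map.mp hx
    exact one_le_intMahlerMeasure (hFirr f hf).ne_zero
  have hprod_ge : ∀ x ∈ F.map intMahlerMeasure, x ≤ (F.map intMahlerMeasure).prod := by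
    intro x hx
    obtain ⟨T, hT⟩ := Multiset.exists_cons_of_mem hx
    rw [hT, Multiset.prod_cons]
    have hT1 : 1 ≤ T.prod :=
      Multiset.one_le_prod (fun y hy => hge1 y (by rw [hT]; exact Multiset.mem_cons_of_mem hy))
    have hx0 : 0 ≤ x := le_trans zero_le_one (hge1 x hx)
    nlinarith
  by_contra hlt
  push Not at hlt
  have hall : ∀ x ∈ F.map intMahlerMeasure, x = 1 := by
    intro x hx
    obtain ⟨f, hf, rfl⟩ := Multiset.mem_map.mp hx
    by_contra hne
    have hgt : 1 < intMahlerMeasure f := lt_of_le_of_ne (hge1 _ hx) (Ne.symm hne)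
    have hfdeg : f.natDegree ≤ 27 := (natDegree_le_of_dvd (hdvd f hf) hp).trans hdeg
    have h2 := lehmer_le_of_irreducible_of_natDegree_le_twentyseven (hFirr f hf) hfdeg hgt
    have h3 := hprod_ge _ hx
    rw [← hMp] at h3
    linarith
  have : (F.map intMahlerMeasure).prod = 1 := Multiset.prod_eq_one hall
  rw [← hMp] at this
  linarith

/-- **A sub-Lehmer polynomial has degree at least `28`.** -/
theorem twentyeight_le_natDegree_of_subLehmer {P : ℤ[X]} (hP : SubLehmer P) : 28 ≤ P.natDegree := by
  by_contra h
  push Not at h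
  have := lehmer_le_of_natDegree_le_twentyseven (p := P) (by omega) hP.1
  exact absurd hP.2 (not_lt.mpr this)

/-- `M(Q(x^k)) = M(Q)`: if `Q(x^k)` is a sub-Lehmer polynomial then so is `Q`. -/
theorem subLehmer_of_subLehmer_expand {Q : ℤ[X]} {k : ℕ} (hk : 1 ≤ k) (h : SubLehmer (expand ℤ k Q)) : SubLehmer Q := by
  rw [SubLehmer, expand_eq_comp_X_pow, intMahlerMeasure_comp_X_pow Q hk] at h
  exact h

/-- **A sub-Lehmer polynomial of degree `< 56` is primitive:** it is not `Q(x^k)` for any `k ≥ 2` and any `Q ∈ ℤ[X]`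
(the base `Q` would be a sub-Lehmer polynomial of degree `≤ 27`, excluded by `twentyeight_le_natDegree_of_subLehmer`).  So the first
open slice of Lehmer's problem in the kernel, degrees `28 … 55`, concerns primitive polynomials only (the class of MRW08 Table 1). -/
theorem ne_expand_of_subLehmer_of_natDegree_lt_fiftysix {P : ℤ[X]} (hP : SubLehmer P) (hdeg : P.natDegree < 56) {k : ℕ}
    (hk : 2 ≤ k) (Q : ℤ[X]) : P ≠ expand ℤ k Q := by
  rintro rfl
  have hQ := subLehmer_of_subLehmer_expand (by omega) hP
  have h28 := twentyeight_le_natDegree_of_subLehmer hQ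
  rw [natDegree_expand] at hdeg
  nlinarith

/-- Census rows in the engines' format, degrees `≤ 27`, below Lehmer's measure: nothing. -/
theorem heightBoundedCensus_subLehmer_of_le_twentyseven {n h : ℕ} (hn : n ≤ 27) :
    HeightBoundedCensus n h (intMahlerMeasure lehmerPoly) [] := by
  refine ⟨fun p hdeg _ h1 h2 => ?_, fun l hl => by simp at hl⟩
  exfalso
  have := lehmer_le_of_natDegree_le_twentyseven (p := p) (by omega) h1
  linarith

/-- **Rungs `N ≤ 27` of the sub-Lehmer ladder, unconditionally, at every height bound `h`.** -/
theorem heightSubLehmerEmptyUpTo_of_le_twentyseven (h : ℕ) {N : ℕ} (hN : N ≤ 27) : HeightSubLehmerEmptyUpTo h N := by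
  intro P hdeg _ hP
  have := twentyeight_le_natDegree_of_subLehmer hP
  omega

/-- Height-1 rungs `N ≤ 27`, unconditionally. -/
theorem height1SubLehmerEmptyUpTo_of_le_twentyseven {N : ℕ} (hN : N ≤ 27) : Height1SubLehmerEmptyUpTo N :=
  (heightSubLehmerEmptyUpTo_one_iff N).mp (heightSubLehmerEmptyUpTo_of_le_twentyseven 1 hN)

/-- Every cell `HeightCell h s d` with core degree `d ≤ 27` holds unconditionally. -/
theorem heightCell_of_le_twentyseven (h : ℕ) (s : Multiset ℕ) {d : ℕ} (hd : d ≤ 27) : HeightCell h s d := by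
  intro Q hdeg _ _ _ _ _ hQ
  have := twentyeight_le_natDegree_of_subLehmer hQ
  omega

/-- **The kernel census of small Mahler measures, degrees `1 … 27`:** the rows of `kernelCensus_le_twentyfive` (bound `13/10`
for `n ≤ 21` and `n = 23`, `61/50` at `n = 22`), the EMPTY degree-26 row at the Lehmer bound `20/17` and the empty row of the odd degree `25`. -/
theorem kernelCensus_le_twentyseven :
    (((DegreeCensus 8 (13 / 10) coresDeg8 ∧ DegreeCensus 10 (13 / 10) coresDeg10 ∧ DegreeCensus 12 (13 / 10) coresDeg12 ∧
      DegreeCensus 14 (13 / 10) coresDeg14 ∧ DegreeCensus 16 (13 / 10) coresDeg16 ∧ DegreeCensus 18 (13 / 10) coresDeg18 ∧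
      DegreeCensus 20 (13 / 10) coresDeg20 ∧
      ∀ n : ℕ, 1 ≤ n → n ≤ 21 → n ≠ 8 → n ≠ 10 → n ≠ 12 → n ≠ 14 → n ≠ 16 → n ≠ 18 → n ≠ 20 →
        DegreeCensus n (13 / 10) []) ∧
    DegreeCensus 22 (61 / 50) [c22_01] ∧ DegreeCensus 23 (13 / 10) []) ∧
    DegreeCensus 24 (20 / 17) [] ∧ DegreeCensus 25 (13 / 10) []) ∧
    DegreeCensus 26 (20 / 17) [] ∧ DegreeCensus 27 (13 / 10) [] := by
  refine ⟨kernelCensus_le_twentyfive, degreeCensus_twentysix_lehmer, ?_⟩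
  have hθ : (13 : ℝ) / 10 ≤ smythTheta := le_of_lt (lt_trans (by norm_num) smythTheta_gt)
  exact degreeCensus_odd_smythTheta (by decide) hθ

end Summit.Ventures.DiscreteObjects.Mahler
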